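import Summits.QuantumFields.YangMills.Theses.LuscherReduction
import Summits.QuantumFields.YangMills.Theorems.FemtoTransferGapBounds
import Summits.QuantumFields.YangMills.Theorems.FemtoTransferGapPositivity

/-!
(v6 CANDIDATE, owner p1 g14 2026-08-26 — NOT REGISTERED (RED had its one reshape this generation, v5): = v5 ∘ the CONJUNCT SPLIT of the crux into its two
one-sided halves `RunningUpper` (1st conjunct: the NO-INTRUDER half — every low fine state ⊥ k constraints has Rayleigh quotient ≤ one-site k-th value × stiff normalisation)
and `RunningLower` (2nd conjunct: the TRIAL-STATE half — one-site optimisers ⊗ stiff Gaussian ground state lifted to `(ℤ/L)³`, plus control of the fine TOP value only), with the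
kernel-checked composition `RunningReduction_of_halves : stub_runningUpper → stub_runningLower → stub_transferValuesNonneg → RunningReduction` (constants merge by max/min;
non-negativity of transfer values needed to enlarge `C`).  Each half is strictly weaker than the crux (different inequality direction) and the halves are different
difficulties (`levelValue` counts from the top: lower bounds need a `(k+1)`-dimensional trial family, upper bounds need all of `ψ ⊥`); together they are the crux
(`runningUpper_of_runningReduction`, `runningLower_of_runningReduction`).  ALSO the honesty lemma `femtoBlocking_of_runningReduction : crux → T2 → S3 → S4 → T1`
(T1 is the crux in leg-1 currency modulo ONE, not a weakening).  Register (successor / on director authorisation) when a seat bites either half: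
`ledger skeleton check <this> --crux stmt-QuantumFields-19978`.  See `DOSSIER-RunningReduction.md` §5 (a).)

(v5, 2026-08-26, planner ym-beyond-p1 g14 — THE ONE RESHAPE OF RED THIS GENERATION, answering a LOCATED owner-audit finding, kernel-checked below as
`stiffModeDecoupling_of_runningReduction`: v4's load-bearing stub S1 `StiffModeDecoupling` is implied by the crux ITSELF with the witness
`B := oneSiteCoupling β L` (its two extra conjuncts are then trivial), i.e. S1 is the crux re-worded up to a relaxation of the effective coupling — the
v4 line hides the whole difficulty in one stub of crux strength (shred/costume-adjacent).  v5 ADDS the renormalisation-group line in LEG-1 CURRENCY: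
T1 `FemtoBlocking` — «`L` time steps of the fine `(ℤ/L)³` transfer operator have the same low zero-flux spectrum, to relative precision `e^{±Cλ²}`, as ONE
step of the ONE-SITE transfer operator at the two-loop-matched coupling `b = 2/λ(β,L)³ = 2/ḡ²(ℓ)`» (space-time blocking `L³ × L ↦ 1³ × 1` at fixed
physical size: energy × size is blocking-invariant up to `O(ḡ^{4/3})`), plus T2 `OneSiteScaling` (the one-site law is linear in `λ_b`: a CONSEQUENCE of
crux `OneSiteLevels`, proved here as `oneSiteScaling_of_oneSiteLevels`), with the NEW kernel-checked composition `RunningReduction_of : T1 → T2 → S3 → S4 →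
RunningReduction` (an `L`-th-root extraction).  v4's composition is KEPT verbatim as `RunningReduction_of_stiff` (S1 → S2 → S3 → S4), so EITHER line closes
the crux; registered stubs after v5 = {`stub_femtoBlocking` (XL, the N29+ ask to leg 1), `stub_oneSiteScaling` (⇐ ONE, in-file), `stub_stiffModeDecoupling`
(XL, Lüscher/Bloch line), `stub_oneSiteLipschitz` (⇐ ONE, landed p415800), `stub_fixedLatticeReduction` (BC5 plan-only rung)}.  Also recorded (def only,
not a stub): T1′ `FemtoStep`, the dyadic ONE-STEP form `2M ↦ M` with summable error `Cλ²/M` — the shape a Bałaban-type inductive RG proof would deliver.)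
(v4, 2026-08-26T01:0xZ: stub `stub_transferValuesNonneg` discharged by name from `Theorems.FemtoTransferGapPositivity` — LANDED p414734 (pair with `…PositivityGram` p414647); delta vs v3 = one import + one proof term; stub set, signatures and composition UNCHANGED.)
(v3, 2026-08-26T00:5xZ: stub `stub_oneSiteTopPos` discharged by name from `Theorems.FemtoTransferGapBounds` — p413762; stub set, signatures and composition UNCHANGED.)
# Birth skeleton (BC3) of crux `RunningReduction` of route `LuscherReduction` (QuantumFields / YangMills; rung leaf R2b1 `FemtoGapOfRecord`)
Planner ym-beyond-p1 g10, 2026-08-25.  Publish after `route open` with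
`ledger crux write <item> Lines/birth.lean --file Lines-birth-RunningReduction.lean` and register with
`ledger skeleton check $(ledger crux dir <item>)/Lines/birth.lean --crux <item>`.
Sorries live ONLY inside `stub_*`; the composition `RunningReduction_of` is kernel-checked and concludes the route decl
`Summit.QuantumFields.YangMills.Theses.LuscherReduction.RunningReduction` BY NAME.
-/

set_option autoImplicit false

noncomputable section

open MeasureTheory Filter Topology Real
open Literature.MathematicalPhysics.QuantumFieldTheory
open Literature.MathematicalPhysics.QuantumLattice
open Literature.Analysis.OperatorTheory.YMMatrixModel

/-! ## BC3 birth skeleton for crux `RunningReduction` (planner ym-beyond-p1 g10, 2026-08-25)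
Four stubs and the kernel-checked composition `RunningReduction_of`; plus the BC5 PLAN-ONLY rung `FixedLatticeReduction` (not used in the
composition).  S1 `StiffModeDecoupling` is the load-bearing stub (adiabatic elimination of the `3(L³−1)` non-constant modes at an EFFECTIVE
one-site coupling `B` obeying two-loop asymptotic freedom `|λ_b(B) − λ/L| ≤ Cλ²/L`; the crux is S1 with `B` pinned to `2L³/λ³`); S2
`OneSiteLipschitz` is Lipschitz regularity of the one-site log level ratios in `λ_b` (a consequence of crux `OneSiteLevels`, finite-dimensional);
S3/S4 are transfer-operator positivity (Osterwalder–Seiler reflection positivity of the Wilson action: the kernel is positive-definite for `β > 0`,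
and the one-site top value is non-degenerate). -/
namespace Summit.QuantumFields.YangMills.Cruxes.RunningReduction.Birth

open Summit.QuantumFields.YangMills.Theorems.FemtoTransferGap

/-- S1 (load-bearing stub): adiabatic decoupling of the stiff modes at an effective one-site coupling with two-loop running. -/
def StiffModeDecoupling : Prop :=
  ∀ k : ℕ, ∃ C lam0 : ℝ, 0 < lam0 ∧ ∀ lam : ℝ, 0 < lam → lam ≤ lam0 →
    ∃ L0 : ℕ, ∀ (L : ℕ) [NeZero L], L0 ≤ L → ∀ β : ℝ, InFemtoWindow lam β L →
      ∃ B : ℝ, oneSiteCoupling β L ≤ 2 * B ∧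
        |bareLambda B - luscherLambda β L / L| ≤ C * luscherLambda β L ^ 2 / L ∧
          levelValue su2Rep L β k * levelValue su2Rep 1 B 0 ≤
              Real.exp (C * luscherLambda β L ^ 2 / L) * (levelValue su2Rep 1 B k * levelValue su2Rep L β 0) ∧
            levelValue su2Rep 1 B k * levelValue su2Rep L β 0 ≤
              Real.exp (C * luscherLambda β L ^ 2 / L) * (levelValue su2Rep L β k * levelValue su2Rep 1 B 0)

/-- S2: Lipschitz regularity in `λ_b` of the one-site log level ratios, `|log(λ_k/λ₀)(B) − log(λ_k/λ₀)(B')| ≤ C(|λ_b − λ_b'| + λ_b² + λ_b'²)`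
(cross-multiplied, junk-robust form). -/
def OneSiteLipschitz : Prop :=
  ∀ k : ℕ, ∃ C B0 : ℝ, ∀ B B' : ℝ, B0 ≤ B → B0 ≤ B' →
    levelValue su2Rep 1 B k * levelValue su2Rep 1 B' 0 ≤
      Real.exp (C * (|bareLambda B - bareLambda B'| + (bareLambda B ^ 2 + bareLambda B' ^ 2))) *
        (levelValue su2Rep 1 B' k * levelValue su2Rep 1 B 0)

/-- S3: transfer values are non-negative at weak bare coupling (positive-definiteness of the Wilson transfer kernel, `β ≥ 1`). -/
def TransferValuesNonneg : Prop :=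
  ∀ (L : ℕ) [NeZero L] (β : ℝ) (k : ℕ), 1 ≤ β → 0 ≤ levelValue su2Rep L β k

/-- S4: the one-site top transfer value is positive (the constant function is a physical test function; the kernel is positive). -/
def OneSiteTopPos : Prop :=
  ∀ B : ℝ, 1 ≤ B → 0 < levelValue su2Rep 1 B 0

/-- BC5 PLAN-ONLY rung (NOT used in the composition): the reduction on every FIXED spatial lattice (constants may depend on `L`; `β → ∞`
through the window) — a statement of finite-dimensional multi-well semiclassics for the transfer operator of a compact-group quantum mechanics
with `3L³` degrees of freedom plus lattice perturbation theory at fixed `L`; first prover target exercising the lever (one site at the running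
coupling) below the uniform-in-`L` crux. -/
def FixedLatticeReduction : Prop :=
  ∀ (L : ℕ) [NeZero L] (k : ℕ), ∃ C lam0 : ℝ, 0 < lam0 ∧ ∀ lam : ℝ, 0 < lam → lam ≤ lam0 → ∀ β : ℝ, InFemtoWindow lam β L →
    levelValue su2Rep L β k * levelValue su2Rep 1 (oneSiteCoupling β L) 0 ≤
        Real.exp (C * luscherLambda β L ^ 2 / L) *
          (levelValue su2Rep 1 (oneSiteCoupling β L) k * levelValue su2Rep L β 0) ∧
      levelValue su2Rep 1 (oneSiteCoupling β L) k * levelValue su2Rep L β 0 ≤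
        Real.exp (C * luscherLambda β L ^ 2 / L) *
          (levelValue su2Rep L β k * levelValue su2Rep 1 (oneSiteCoupling β L) 0)

/-! ### v5: the renormalisation-group line (leg-1 currency) -/

/-- **T1 `FemtoBlocking` (load-bearing stub of the RG line; the node-N29+ ask to leg 1).**  For every level `k`: deep in the femto window,
`L` TIME STEPS of the fine `(ℤ/L)³` zero-flux transfer operator and ONE step of the ONE-SITE transfer operator at the two-loop-matched coupling
`b = 2/λ(β,L)³` (bare parameter `λ_b(b) = λ(β,L)` exactly) have the same `k`-th level ratio to relative precision `e^{±Cλ²}`: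
`(λ_k/λ₀)(β,L)^L ≍ (λ_k/λ₀)^{one-site}(b)`, i.e. `|L·E_k(β,L) − E_k^{os}(b)| ≤ Cλ²` — ENERGY × SIZE IS INVARIANT UNDER BLOCKING THE SPACE-TIME
BOX `L³ × L ↦ 1³ × 1` AT MATCHED RUNNING COUPLING, up to `O(ḡ^{4/3})` (which absorbs all lattice artefacts and every finite matching constant; only
the one-loop `4b₀ log L` and two-loop `log log` terms of the label are load-bearing).  Cross-multiplied, junk-robust form.  WHY IT MIGHT FAIL: only with
the labels (`b₀, b₁`, `β = 2/g₀²`) mis-normalised — as for the crux; physically it is Lüscher's universality statement [Luscher1983, §3–4],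
[LuscherMunster1984, §2].  No constructive proof in print: this is what a Bałaban-type small-field renormalisation group run to the LAST scale of a
femto box (running coupling small at EVERY scale) with SPECTRAL (transfer-operator) output would deliver. -/
def FemtoBlocking : Prop :=
  ∀ k : ℕ, ∃ C lam0 : ℝ, 0 < lam0 ∧ ∀ lam : ℝ, 0 < lam → lam ≤ lam0 →
    ∃ L0 : ℕ, ∀ (L : ℕ) [NeZero L], L0 ≤ L → ∀ β : ℝ, InFemtoWindow lam β L →
      levelValue su2Rep L β k ^ L * levelValue su2Rep 1 (2 / luscherLambda β L ^ 3) 0 ≤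
          Real.exp (C * luscherLambda β L ^ 2) *
            (levelValue su2Rep 1 (2 / luscherLambda β L ^ 3) k * levelValue su2Rep L β 0 ^ L) ∧
        levelValue su2Rep 1 (2 / luscherLambda β L ^ 3) k * levelValue su2Rep L β 0 ^ L ≤
          Real.exp (C * luscherLambda β L ^ 2) *
            (levelValue su2Rep L β k ^ L * levelValue su2Rep 1 (2 / luscherLambda β L ^ 3) 0)

/-- **T2 `OneSiteScaling`** (⇐ crux `OneSiteLevels`, see `oneSiteScaling_of_oneSiteLevels` below): the one-site law is LINEAR in the bare parameter
— `L` steps of the one-site operator at coupling `L³b` (`λ_b = λ_b(b)/L`) match one step at coupling `b`, to relative precision `e^{±Cλ_b(b)²}`. -/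
def OneSiteScaling : Prop :=
  ∀ k : ℕ, ∃ C B0 : ℝ, ∀ (L : ℕ) [NeZero L] (b : ℝ), B0 ≤ b →
    levelValue su2Rep 1 ((L : ℝ) ^ 3 * b) k ^ L * levelValue su2Rep 1 b 0 ≤
        Real.exp (C * bareLambda b ^ 2) * (levelValue su2Rep 1 b k * levelValue su2Rep 1 ((L : ℝ) ^ 3 * b) 0 ^ L) ∧
      levelValue su2Rep 1 b k * levelValue su2Rep 1 ((L : ℝ) ^ 3 * b) 0 ^ L ≤
        Real.exp (C * bareLambda b ^ 2) * (levelValue su2Rep 1 ((L : ℝ) ^ 3 * b) k ^ L * levelValue su2Rep 1 b 0)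

/-- **T1′ `FemtoStep` (NOT a stub — the dyadic ONE-STEP form of T1, recorded as the shape of the node-N29+ statement an inductive Bałaban-type RG
proof would deliver):** blocking `(2M)³ × 2M ↦ M³ × M` at matched two-loop label `λ(β', M) = λ(β, 2M)` changes energy × size by a SUMMABLE
`Cλ²/M` (`|2M·E_k(β,2M) − M·E_k(β',M)| ≤ Cλ²/M`, i.e. `(λ_k/λ₀)(β,2M)² ≍ (λ_k/λ₀)(β',M)` to relative precision `e^{±Cλ²/M²}`); telescoping over
`M = L/2, …, 1` gives `FemtoBlocking` along dyadic `L` with constant `2C` (the matched couplings exist by monotonicity of `invRunningCoupling` in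
`β ≥ 1`).  [Luscher1983, §3] -/
def FemtoStep : Prop :=
  ∀ k : ℕ, ∃ C lam0 : ℝ, 0 < lam0 ∧ ∀ lam : ℝ, 0 < lam → lam ≤ lam0 →
    ∀ (M : ℕ) [NeZero M] [NeZero (2 * M)] (β β' : ℝ), InFemtoWindow lam β (2 * M) → 1 ≤ β' →
      luscherLambda β' M = luscherLambda β (2 * M) →
        levelValue su2Rep (2 * M) β k ^ 2 * levelValue su2Rep M β' 0 ≤
            Real.exp (C * luscherLambda β (2 * M) ^ 2 / (M : ℝ) ^ 2) * (levelValue su2Rep M β' k * levelValue su2Rep (2 * M) β 0 ^ 2) ∧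
          levelValue su2Rep M β' k * levelValue su2Rep (2 * M) β 0 ^ 2 ≤
            Real.exp (C * luscherLambda β (2 * M) ^ 2 / (M : ℝ) ^ 2) * (levelValue su2Rep (2 * M) β k ^ 2 * levelValue su2Rep M β' 0)

/-- **U `RunningUpper`** (v6; 1st conjunct of the crux — the no-intruder half): `λ_k(L,β)·μ₀(B(β,L)) ≤ e^{Cλ²/L}·μ_k(B(β,L))·λ₀(L,β)`. -/
def RunningUpper : Prop :=
  ∀ k : ℕ, ∃ C lam0 : ℝ, 0 < lam0 ∧ ∀ lam : ℝ, 0 < lam → lam ≤ lam0 →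
    ∃ L0 : ℕ, ∀ (L : ℕ) [NeZero L], L0 ≤ L → ∀ β : ℝ, InFemtoWindow lam β L →
      levelValue su2Rep L β k * levelValue su2Rep 1 (oneSiteCoupling β L) 0 ≤
        Real.exp (C * luscherLambda β L ^ 2 / L) * (levelValue su2Rep 1 (oneSiteCoupling β L) k * levelValue su2Rep L β 0)

/-- **D `RunningLower`** (v6; 2nd conjunct of the crux — the trial-state half): `μ_k(B(β,L))·λ₀(L,β) ≤ e^{Cλ²/L}·λ_k(L,β)·μ₀(B(β,L))`. -/
def RunningLower : Prop :=
  ∀ k : ℕ, ∃ C lam0 : ℝ, 0 < lam0 ∧ ∀ lam : ℝ, 0 < lam → lam ≤ lam0 →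
    ∃ L0 : ℕ, ∀ (L : ℕ) [NeZero L], L0 ≤ L → ∀ β : ℝ, InFemtoWindow lam β L →
      levelValue su2Rep 1 (oneSiteCoupling β L) k * levelValue su2Rep L β 0 ≤
        Real.exp (C * luscherLambda β L ^ 2 / L) * (levelValue su2Rep L β k * levelValue su2Rep 1 (oneSiteCoupling β L) 0)

/-! ### Registered stub statements (gate shape: each declared stub `theorem stub_<name> : Stmt.stub_<name> := by sorry`,
the composition's hypotheses are the `Stmt.stub_<name>` by name). -/
namespace Stmt

/-- = `FemtoBlocking` (statement of the declared stub `stub_femtoBlocking`; v5). -/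
abbrev stub_femtoBlocking : Prop := FemtoBlocking

/-- = `OneSiteScaling` (statement of the declared stub `stub_oneSiteScaling`; v5; ⇐ crux `OneSiteLevels`). -/
abbrev stub_oneSiteScaling : Prop := OneSiteScaling

/-- = `StiffModeDecoupling` (statement of the declared stub `stub_stiffModeDecoupling`). -/
abbrev stub_stiffModeDecoupling : Prop := StiffModeDecoupling

/-- = `OneSiteLipschitz` (statement of the declared stub `stub_oneSiteLipschitz`). -/
abbrev stub_oneSiteLipschitz : Prop := OneSiteLipschitz

/-- = `TransferValuesNonneg` (statement of the declared stub `stub_transferValuesNonneg`). -/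
abbrev stub_transferValuesNonneg : Prop := TransferValuesNonneg

/-- = `OneSiteTopPos` (statement of the declared stub `stub_oneSiteTopPos`). -/
abbrev stub_oneSiteTopPos : Prop := OneSiteTopPos

/-- = `FixedLatticeReduction` (statement of the declared stub `stub_fixedLatticeReduction`). -/
abbrev stub_fixedLatticeReduction : Prop := FixedLatticeReduction

/-- = `RunningUpper` (statement of the declared stub `stub_runningUpper`; v6). -/
abbrev stub_runningUpper : Prop := RunningUpper

/-- = `RunningLower` (statement of the declared stub `stub_runningLower`; v6). -/
abbrev stub_runningLower : Prop := RunningLower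

end Stmt

theorem stub_femtoBlocking : Stmt.stub_femtoBlocking := by
  sorry

/- ⇐ crux `OneSiteLevels` by `oneSiteScaling_of_oneSiteLevels` (this file); closes when ONE closes. -/
theorem stub_oneSiteScaling : Stmt.stub_oneSiteScaling := by
  sorry

theorem stub_stiffModeDecoupling : Stmt.stub_stiffModeDecoupling := by
  sorry

/- ⇐ crux `OneSiteLevels` by the landed `Theorems.FemtoTransferGap.oneSiteLipschitz_of_oneSiteLevels` (p415800). -/
theorem stub_oneSiteLipschitz : Stmt.stub_oneSiteLipschitz := by
  sorry

/- v4 (2026-08-26): discharged BY NAME from the landed support module `Theorems/FemtoTransferGapPositivity.lean` (p414734; Gram part p414647). -/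
theorem stub_transferValuesNonneg : Stmt.stub_transferValuesNonneg :=
  Summit.QuantumFields.YangMills.Theorems.FemtoTransferGap.transferValuesNonneg

/- v3 (2026-08-26): discharged BY NAME from the landed support module `Theorems/FemtoTransferGapBounds.lean` (p413762, b60f800b40db). -/
theorem stub_oneSiteTopPos : Stmt.stub_oneSiteTopPos :=
  Summit.QuantumFields.YangMills.Theorems.FemtoTransferGap.oneSiteTopPos

theorem stub_fixedLatticeReduction : Stmt.stub_fixedLatticeReduction := by
  sorry

theorem stub_runningUpper : Stmt.stub_runningUpper := by
  sorry

theorem stub_runningLower : Stmt.stub_runningLower := by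
  sorry

/-! ### Elementary helpers -/

/-- `λ_b(2/l³) = l`. -/
theorem bareLambda_two_div_cube {l : ℝ} (hl : 0 < l) : bareLambda (2 / l ^ 3) = l := by
  unfold bareLambda
  have hq : (2 : ℝ) / (2 / l ^ 3) = l ^ 3 := by field_simp
  rw [hq]
  have h13 : ((1 : ℝ) / 3) = ((3 : ℕ) : ℝ)⁻¹ := by norm_num
  rw [h13]
  exact Real.pow_rpow_inv_natCast hl.le (by norm_num)

/-- `λ_b(L³ b) = λ_b(b)/L`. -/
theorem bareLambda_cube_mul {b : ℝ} (hb : 0 < b) (L : ℕ) [NeZero L] : bareLambda ((L : ℝ) ^ 3 * b) = bareLambda b / L := by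
  have hL : (0 : ℝ) < L := Nat.cast_pos.mpr (NeZero.pos L)
  unfold bareLambda
  have h13 : ((1 : ℝ) / 3) = ((3 : ℕ) : ℝ)⁻¹ := by norm_num
  rw [h13, mul_comm, ← div_div, Real.div_rpow (by positivity) (by positivity),
    Real.pow_rpow_inv_natCast hL.le (by norm_num)]

private theorem le_exp_mul_of_exp_neg_mul_le {a u v : ℝ} (h : Real.exp (-a) * u ≤ v) : u ≤ Real.exp a * v := by
  have := mul_le_mul_of_nonneg_left h (Real.exp_pos a).le
  rwa [← mul_assoc, ← Real.exp_add, add_neg_cancel, Real.exp_zero, one_mul] at this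

private theorem eq_zero_of_pow_mul_le_zero {x y : ℝ} {n : ℕ} (hn : n ≠ 0) (hx : 0 ≤ x) (hy : 0 < y) (h : x ^ n * y ≤ 0) : x = 0 := by
  have h2 : x ^ n ≤ 0 := by
    by_contra hcon
    exact absurd h (not_le.mpr (mul_pos (not_le.mp hcon) hy))
  exact (pow_eq_zero_iff hn).mp (le_antisymm h2 (pow_nonneg hx n))

set_option maxHeartbeats 800000 in
/-- **Composition of the RG line (v5): T1 → T2 → S3 → S4 → the crux, by name.**  In the window put `l = λ(β,L)`, `b = 2/l³` (`λ_b(b) = l`,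
`b ≥ 1/(4lam³) ≥ max(B₀,1)` once `lam ≤ min(1, 1/(4max(B₀,1)))`) and `B(β,L) = L³ b`.  T1 compares `(λ_k/λ₀)(β,L)^L` with the one-site ratio at `b`,
T2 compares the latter with `((λ_k/λ₀)^{os}(L³b))^L`; multiply, cancel the one-site values at `b` (positive by S4, or zero — then both sides vanish),
write `e^{Cl²} = (e^{Cl²/L})^L` and extract the `L`-th root (all transfer values are `≥ 0` by S3). -/
theorem RunningReduction_of (h₁ : Stmt.stub_femtoBlocking) (h₂ : Stmt.stub_oneSiteScaling) (h₃ : Stmt.stub_transferValuesNonneg)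
    (h₄ : Stmt.stub_oneSiteTopPos) : Summit.QuantumFields.YangMills.Theses.LuscherReduction.RunningReduction := by
  show Summit.QuantumFields.YangMills.Theorems.FemtoTransferGap.RunningReduction
  intro k
  obtain ⟨C₁, l₁, hl₁, H₁⟩ := h₁ k
  obtain ⟨C₂, B₀, H₂⟩ := h₂ k
  set M : ℝ := max B₀ 1 with hM
  have hM1 : 1 ≤ M := le_max_right _ _
  have hMB : B₀ ≤ M := le_max_left _ _
  have hM0 : 0 < M := by linarith
  refine ⟨|C₁| + |C₂|, min l₁ (min 1 (1 / (4 * M))), lt_min hl₁ (lt_min one_pos (by positivity)), ?_⟩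
  intro lam hlam hle
  have hle₁ : lam ≤ l₁ := hle.trans (min_le_left _ _)
  have hlam1 : lam ≤ 1 := (hle.trans (min_le_right _ _)).trans (min_le_left _ _)
  have hleM : lam ≤ 1 / (4 * M) := (hle.trans (min_le_right _ _)).trans (min_le_right _ _)
  obtain ⟨L0, HL⟩ := H₁ lam hlam hle₁
  refine ⟨L0, ?_⟩
  intro L _ hL β hw
  have hl : 0 < luscherLambda β L := luscherLambda_pos_of_window hlam hw
  have hβ1 : 1 ≤ β := hw.1
  have hl2 : luscherLambda β L ≤ 2 * lam := hw.2.2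
  have hosc : oneSiteCoupling β L = (L : ℝ) ^ 3 * (2 / luscherLambda β L ^ 3) := by
    unfold oneSiteCoupling; ring
  have hlb : bareLambda (2 / luscherLambda β L ^ 3) = luscherLambda β L := bareLambda_two_div_cube hl
  obtain ⟨hU1, hU2⟩ := HL L hL β hw
  set l : ℝ := luscherLambda β L with hl_def
  set b : ℝ := 2 / l ^ 3 with hb_def
  have hLpos : (0 : ℝ) < L := Nat.cast_pos.mpr (NeZero.pos L)
  have hL1 : (1 : ℝ) ≤ L := by exact_mod_cast NeZero.one_le
  have hLne : (L : ℕ) ≠ 0 := NeZero.ne L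
  -- b ≥ M ≥ max(B₀,1)
  have hbM : M ≤ b := by
    have h1 : 1 / (4 * lam ^ 3) ≤ b := by
      rw [hb_def, div_le_div_iff₀ (by positivity) (by positivity)]
      have : l ^ 3 ≤ (2 * lam) ^ 3 := by gcongr
      nlinarith [this]
    have h2 : M ≤ 1 / (4 * lam ^ 3) := by
      rw [le_div_iff₀ (by positivity)]
      have hlam3 : lam ^ 3 ≤ lam := pow_le_of_le_one hlam.le hlam1 three_ne_zero
      have h3 := hleM
      rw [le_div_iff₀ (by positivity)] at h3
      calc M * (4 * lam ^ 3) = 4 * M * lam ^ 3 := by ring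
        _ ≤ 4 * M * lam := by gcongr
        _ = lam * (4 * M) := by ring
        _ ≤ 1 := h3
    exact h2.trans h1
  have hb1 : 1 ≤ b := hM1.trans hbM
  have hbB0 : B₀ ≤ b := hMB.trans hbM
  have hosc1 : 1 ≤ oneSiteCoupling β L := by
    rw [hosc]
    have : (1 : ℝ) ≤ (L : ℝ) ^ 3 := one_le_pow₀ hL1
    nlinarith
  -- the one-site scaling comparison at (L, b), rewritten to the crux's vocabulary
  obtain ⟨hV1, hV2⟩ := H₂ L b hbB0
  rw [hlb, ← hosc] at hV1 hV2
  -- signs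
  have hxk : 0 ≤ levelValue su2Rep L β k := h₃ L β k hβ1
  have hx0 : 0 ≤ levelValue su2Rep L β 0 := h₃ L β 0 hβ1
  have hyk : 0 ≤ levelValue su2Rep 1 b k := h₃ 1 b k hb1
  have hy0 : 0 < levelValue su2Rep 1 b 0 := h₄ b hb1
  have hzk : 0 ≤ levelValue su2Rep 1 (oneSiteCoupling β L) k := h₃ 1 _ k hosc1
  have hz0 : 0 < levelValue su2Rep 1 (oneSiteCoupling β L) 0 := h₄ _ hosc1
  -- names
  set xk := levelValue su2Rep L β k with hxk_def
  set x0 := levelValue su2Rep L β 0 with hx0_def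
  set yk := levelValue su2Rep 1 b k with hyk_def
  set y0 := levelValue su2Rep 1 b 0 with hy0_def
  set zk := levelValue su2Rep 1 (oneSiteCoupling β L) k with hzk_def
  set z0 := levelValue su2Rep 1 (oneSiteCoupling β L) 0 with hz0_def
  set e : ℝ := Real.exp ((|C₁| + |C₂|) * l ^ 2 / L) with he_def
  have he0 : 0 < e := Real.exp_pos _
  -- exponential bookkeeping: e^{C₁l²} e^{C₂l²} ≤ e^{(|C₁|+|C₂|)l²} = e^L
  have hexp : Real.exp (C₁ * l ^ 2) * Real.exp (C₂ * l ^ 2) ≤ e ^ L := by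
    rw [← Real.exp_add, he_def, ← Real.exp_nat_mul, Real.exp_le_exp]
    have h1 : C₁ * l ^ 2 ≤ |C₁| * l ^ 2 := mul_le_mul_of_nonneg_right (le_abs_self _) (sq_nonneg _)
    have h2 : C₂ * l ^ 2 ≤ |C₂| * l ^ 2 := mul_le_mul_of_nonneg_right (le_abs_self _) (sq_nonneg _)
    have h3 : (L : ℝ) * ((|C₁| + |C₂|) * l ^ 2 / L) = (|C₁| + |C₂|) * l ^ 2 := by field_simp
    rw [h3]; linarith
  rcases hyk.eq_or_lt with hyk0 | hykpos
  · -- degenerate case `λ_k^{os}(b) = 0`: then `λ_k(β,L) = 0` (by T1) and `λ_k^{os}(B) = 0` (by T2); both inequalities read `0 ≤ …`.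
    rw [← hyk0, zero_mul, mul_zero] at hU1 hV1
    have hxk0 : xk = 0 := eq_zero_of_pow_mul_le_zero hLne hxk hy0 hU1
    have hzk0 : zk = 0 := eq_zero_of_pow_mul_le_zero hLne hzk hy0 hV1
    refine ⟨?_, ?_⟩
    · rw [hxk0, zero_mul]; exact mul_nonneg (Real.exp_pos _).le (mul_nonneg hzk hx0)
    · rw [hzk0, zero_mul]; exact mul_nonneg (Real.exp_pos _).le (mul_nonneg hxk hz0.le)
  · have hyy : 0 < y0 * yk := mul_pos hy0 hykpos
    refine ⟨?_, ?_⟩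
    · -- λ_k(L)·μ₀(B) ≤ e·(μ_k(B)·λ₀(L))
      have key : (xk * z0) ^ L * (y0 * yk) ≤ (e * (zk * x0)) ^ L * (y0 * yk) := by
        calc (xk * z0) ^ L * (y0 * yk) = (xk ^ L * y0) * (yk * z0 ^ L) := by rw [mul_pow]; ring
          _ ≤ (Real.exp (C₁ * l ^ 2) * (yk * x0 ^ L)) * (Real.exp (C₂ * l ^ 2) * (zk ^ L * y0)) :=
              mul_le_mul hU1 hV2 (mul_nonneg hyk (pow_nonneg hz0.le L)) (mul_nonneg (Real.exp_pos _).le (mul_nonneg hyk (pow_nonneg hx0 L)))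
          _ = (Real.exp (C₁ * l ^ 2) * Real.exp (C₂ * l ^ 2)) * ((zk * x0) ^ L * (y0 * yk)) := by rw [mul_pow]; ring
          _ ≤ e ^ L * ((zk * x0) ^ L * (y0 * yk)) :=
              mul_le_mul_of_nonneg_right hexp (mul_nonneg (pow_nonneg (mul_nonneg hzk hx0) L) hyy.le)
          _ = (e * (zk * x0)) ^ L * (y0 * yk) := by rw [mul_pow]; ring
      have key' : (xk * z0) ^ L ≤ (e * (zk * x0)) ^ L := le_of_mul_le_mul_right key hyy
      exact (pow_le_pow_iff_left₀ (mul_nonneg hxk hz0.le) (mul_nonneg he0.le (mul_nonneg hzk hx0)) hLne).mp key'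
    · -- μ_k(B)·λ₀(L) ≤ e·(λ_k(L)·μ₀(B))
      have key : (zk * x0) ^ L * (y0 * yk) ≤ (e * (xk * z0)) ^ L * (y0 * yk) := by
        calc (zk * x0) ^ L * (y0 * yk) = (yk * x0 ^ L) * (zk ^ L * y0) := by rw [mul_pow]; ring
          _ ≤ (Real.exp (C₁ * l ^ 2) * (xk ^ L * y0)) * (Real.exp (C₂ * l ^ 2) * (yk * z0 ^ L)) :=
              mul_le_mul hU2 hV1 (mul_nonneg (pow_nonneg hzk L) hy0.le) (mul_nonneg (Real.exp_pos _).le (mul_nonneg (pow_nonneg hxk L) hy0.le))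
          _ = (Real.exp (C₁ * l ^ 2) * Real.exp (C₂ * l ^ 2)) * ((xk * z0) ^ L * (y0 * yk)) := by rw [mul_pow]; ring
          _ ≤ e ^ L * ((xk * z0) ^ L * (y0 * yk)) :=
              mul_le_mul_of_nonneg_right hexp (mul_nonneg (pow_nonneg (mul_nonneg hxk hz0.le) L) hyy.le)
          _ = (e * (xk * z0)) ^ L * (y0 * yk) := by rw [mul_pow]; ring
      have key' : (zk * x0) ^ L ≤ (e * (xk * z0)) ^ L := le_of_mul_le_mul_right key hyy
      exact (pow_le_pow_iff_left₀ (mul_nonneg hzk hx0) (mul_nonneg he0.le (mul_nonneg hxk hz0.le)) hLne).mp key'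

set_option maxHeartbeats 800000 in
/-- v4 composition (KEPT; Lüscher/Bloch line): S1 → S2 → S3 → S4 → the crux, by name.  In the window take the effective coupling `B` of S1; `B ≥ osc/2 ≥ max(B₀,1)` and
`osc ≥ 1/(4lam³) ≥ 2max(B₀,1)` once `lam ≤ 1/(8 max(B₀,1))`; chain S1 (femto ↔ one-site at `B`) with S2 (one-site at `B` ↔ one-site at `osc`),
cancel `λ₀^{os}(B) > 0`, and bound the Lipschitz modulus by `(|C₁|+5)λ²/L` using `λ_b(osc) = λ/L`, `|λ_b(B) − λ/L| ≤ C₁λ²/L`, `|C₁|λ ≤ 1`. -/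
theorem RunningReduction_of_stiff (h₁ : Stmt.stub_stiffModeDecoupling) (h₂ : Stmt.stub_oneSiteLipschitz) (h₃ : Stmt.stub_transferValuesNonneg)
    (h₄ : Stmt.stub_oneSiteTopPos) : Summit.QuantumFields.YangMills.Theses.LuscherReduction.RunningReduction := by
  show Summit.QuantumFields.YangMills.Theorems.FemtoTransferGap.RunningReduction
  intro k
  obtain ⟨C₁, l₁, hl₁, H₁⟩ := h₁ k
  obtain ⟨C₂, B₀, H₂⟩ := h₂ k
  set M : ℝ := max B₀ 1 with hM
  have hM1 : 1 ≤ M := le_max_right _ _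
  have hMB : B₀ ≤ M := le_max_left _ _
  have hM0 : 0 < M := by linarith
  set A : ℝ := max |C₁| 1 with hA
  have hA1 : 1 ≤ A := le_max_right _ _
  have hAC : |C₁| ≤ A := le_max_left _ _
  have hA0 : 0 < A := by linarith
  refine ⟨|C₁| + |C₂| * (|C₁| + 5), min l₁ (min (1 / (2 * A)) (1 / (8 * M))),
    lt_min hl₁ (lt_min (by positivity) (by positivity)), ?_⟩
  intro lam hlam hle
  have hle₁ : lam ≤ l₁ := hle.trans (min_le_left _ _)
  have hleA : lam ≤ 1 / (2 * A) := (hle.trans (min_le_right _ _)).trans (min_le_left _ _)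
  have hleM : lam ≤ 1 / (8 * M) := (hle.trans (min_le_right _ _)).trans (min_le_right _ _)
  obtain ⟨L0, HL⟩ := H₁ lam hlam hle₁
  refine ⟨L0, ?_⟩
  intro L _ hL β hw
  obtain ⟨B, hBosc, hmatch, hup, hlow⟩ := HL L hL β hw
  have hl : 0 < luscherLambda β L := luscherLambda_pos_of_window hlam hw
  have hosc_ge : 1 / (4 * lam ^ 3) ≤ oneSiteCoupling β L := oneSiteCoupling_ge_of_window hlam hw
  have hlb_osc : bareLambda (oneSiteCoupling β L) = luscherLambda β L / L := bareLambda_oneSiteCoupling hl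
  have hβ1 : 1 ≤ β := hw.1
  have hl2 : luscherLambda β L ≤ 2 * lam := hw.2.2
  set l : ℝ := luscherLambda β L with hl_def
  set osc : ℝ := oneSiteCoupling β L with hosc_def
  have hLpos : (0 : ℝ) < L := Nat.cast_pos.mpr (NeZero.pos L)
  have hL1 : (1 : ℝ) ≤ L := by exact_mod_cast NeZero.one_le
  -- lam ≤ 1/2
  have hlam_half : lam ≤ 1 / 2 := by
    have : 1 / (2 * A) ≤ 1 / 2 :=
      div_le_div_of_nonneg_left (by norm_num) (by norm_num) (by linarith)
    exact hleA.trans this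
  have hlam1 : lam ≤ 1 := by linarith
  have hl1 : l ≤ 1 := by linarith
  -- |C₁| * l ≤ 1
  have hC1l : |C₁| * l ≤ 1 := by
    have h1 : |C₁| * l ≤ A * (2 * lam) := mul_le_mul hAC hl2 hl.le hA0.le
    have h2 : A * (2 * lam) ≤ A * (2 * (1 / (2 * A))) := by gcongr
    have h3 : A * (2 * (1 / (2 * A))) = 1 := by field_simp
    linarith
  -- osc ≥ 2M, hence osc, B ≥ M ≥ max(B₀, 1)
  have hosc2M : 2 * M ≤ osc := by
    have hlam3 : lam ^ 3 ≤ lam := pow_le_of_le_one hlam.le hlam1 three_ne_zero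
    have h2 : 2 * M ≤ 1 / (4 * lam ^ 3) := by
      rw [le_div_iff₀ (by positivity)]
      have h3 : lam ≤ 1 / (8 * M) := hleM
      rw [le_div_iff₀ (by positivity)] at h3
      calc 2 * M * (4 * lam ^ 3) = 8 * M * lam ^ 3 := by ring
        _ ≤ 8 * M * lam := by gcongr
        _ = lam * (8 * M) := by ring
        _ ≤ 1 := h3
    exact h2.trans hosc_ge
  have hoscM : M ≤ osc := by linarith
  have hosc1 : 1 ≤ osc := hM1.trans hoscM
  have hoscB0 : B₀ ≤ osc := hMB.trans hoscM
  have hBM : M ≤ B := by linarith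
  have hB1 : 1 ≤ B := hM1.trans hBM
  have hBB0 : B₀ ≤ B := hMB.trans hBM
  have hB0 : 0 < B := by linarith
  -- bare parameters: λ_b(osc) = l/L, 0 < λ_b(B) ≤ 2l/L
  have hlbB_pos : 0 < bareLambda B := by
    unfold bareLambda; exact Real.rpow_pos_of_pos (by positivity) _
  have hlbB_le : bareLambda B ≤ 2 * l / L := by
    have h1 : bareLambda B - l / L ≤ C₁ * l ^ 2 / L := (le_abs_self _).trans hmatch
    have h2 : C₁ * l ^ 2 / L ≤ |C₁| * l ^ 2 / L := by gcongr; exact le_abs_self C₁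
    have h3 : |C₁| * l ^ 2 / L ≤ l / L := by
      apply div_le_div_of_nonneg_right _ hLpos.le
      have : |C₁| * l ^ 2 = (|C₁| * l) * l := by ring
      rw [this]
      exact mul_le_of_le_one_left hl.le hC1l
    have h4 : l / L + l / L = 2 * l / L := by ring
    linarith
  -- the Lipschitz modulus is ≤ (|C₁| + 5) l²/L
  have hl2L : (l / L) ^ 2 ≤ l ^ 2 / L := by
    rw [div_pow]
    have hLL : (L : ℝ) ≤ (L : ℝ) ^ 2 := by rw [sq]; exact le_mul_of_one_le_left hLpos.le hL1
    exact div_le_div_of_nonneg_left (sq_nonneg l) hLpos hLL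
  have hlbB_sq : bareLambda B ^ 2 ≤ 4 * (l ^ 2 / L) := by
    have h1 : bareLambda B ^ 2 ≤ (2 * l / L) ^ 2 := pow_le_pow_left₀ hlbB_pos.le hlbB_le 2
    have h2 : (2 * l / L) ^ 2 = 4 * (l / L) ^ 2 := by ring
    rw [h2] at h1
    linarith [hl2L]
  have habs : |bareLambda B - bareLambda osc| ≤ |C₁| * (l ^ 2 / L) := by
    rw [hlb_osc]
    have h2 : C₁ * l ^ 2 / L ≤ |C₁| * l ^ 2 / L := by gcongr; exact le_abs_self C₁
    have h3 : |C₁| * l ^ 2 / L = |C₁| * (l ^ 2 / L) := by ring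
    linarith [hmatch]
  have hD : |bareLambda B - bareLambda osc| + (bareLambda B ^ 2 + bareLambda osc ^ 2) ≤ (|C₁| + 5) * (l ^ 2 / L) := by
    rw [hlb_osc] at habs ⊢
    linarith [habs, hlbB_sq, hl2L]
  have hD' : |bareLambda osc - bareLambda B| + (bareLambda osc ^ 2 + bareLambda B ^ 2) ≤ (|C₁| + 5) * (l ^ 2 / L) := by
    rw [abs_sub_comm]; linarith [hD]
  have hD0 : 0 ≤ |bareLambda B - bareLambda osc| + (bareLambda B ^ 2 + bareLambda osc ^ 2) := by positivity
  have hD0' : 0 ≤ |bareLambda osc - bareLambda B| + (bareLambda osc ^ 2 + bareLambda B ^ 2) := by positivity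
  -- exponential bookkeeping
  have he1 : Real.exp (C₁ * l ^ 2 / L) ≤ Real.exp (|C₁| * (l ^ 2 / L)) := by
    apply Real.exp_le_exp.mpr
    have h2 : C₁ * l ^ 2 / L ≤ |C₁| * l ^ 2 / L := by gcongr; exact le_abs_self C₁
    have h3 : |C₁| * l ^ 2 / L = |C₁| * (l ^ 2 / L) := by ring
    linarith
  have he2a : Real.exp (C₂ * (|bareLambda B - bareLambda osc| + (bareLambda B ^ 2 + bareLambda osc ^ 2))) ≤
      Real.exp (|C₂| * ((|C₁| + 5) * (l ^ 2 / L))) := by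
    apply Real.exp_le_exp.mpr
    calc C₂ * (|bareLambda B - bareLambda osc| + (bareLambda B ^ 2 + bareLambda osc ^ 2))
        ≤ |C₂| * (|bareLambda B - bareLambda osc| + (bareLambda B ^ 2 + bareLambda osc ^ 2)) :=
          mul_le_mul_of_nonneg_right (le_abs_self C₂) hD0
      _ ≤ |C₂| * ((|C₁| + 5) * (l ^ 2 / L)) := mul_le_mul_of_nonneg_left hD (abs_nonneg C₂)
  have he2b : Real.exp (C₂ * (|bareLambda osc - bareLambda B| + (bareLambda osc ^ 2 + bareLambda B ^ 2))) ≤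
      Real.exp (|C₂| * ((|C₁| + 5) * (l ^ 2 / L))) := by
    apply Real.exp_le_exp.mpr
    calc C₂ * (|bareLambda osc - bareLambda B| + (bareLambda osc ^ 2 + bareLambda B ^ 2))
        ≤ |C₂| * (|bareLambda osc - bareLambda B| + (bareLambda osc ^ 2 + bareLambda B ^ 2)) :=
          mul_le_mul_of_nonneg_right (le_abs_self C₂) hD0'
      _ ≤ |C₂| * ((|C₁| + 5) * (l ^ 2 / L)) := mul_le_mul_of_nonneg_left hD' (abs_nonneg C₂)
  have hsum : Real.exp (|C₁| * (l ^ 2 / L)) * Real.exp (|C₂| * ((|C₁| + 5) * (l ^ 2 / L))) =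
      Real.exp ((|C₁| + |C₂| * (|C₁| + 5)) * l ^ 2 / L) := by
    rw [← Real.exp_add]; congr 1; ring
  have he12a : Real.exp (C₁ * l ^ 2 / L) *
      Real.exp (C₂ * (|bareLambda B - bareLambda osc| + (bareLambda B ^ 2 + bareLambda osc ^ 2))) ≤
        Real.exp ((|C₁| + |C₂| * (|C₁| + 5)) * l ^ 2 / L) := by
    rw [← hsum]; exact mul_le_mul he1 he2a (Real.exp_pos _).le (Real.exp_pos _).le
  have he12b : Real.exp (C₁ * l ^ 2 / L) *
      Real.exp (C₂ * (|bareLambda osc - bareLambda B| + (bareLambda osc ^ 2 + bareLambda B ^ 2))) ≤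
        Real.exp ((|C₁| + |C₂| * (|C₁| + 5)) * l ^ 2 / L) := by
    rw [← hsum]; exact mul_le_mul he1 he2b (Real.exp_pos _).le (Real.exp_pos _).le
  -- signs
  have hμ0o : 0 ≤ levelValue su2Rep 1 osc 0 := h₃ 1 osc 0 hosc1
  have hμko : 0 ≤ levelValue su2Rep 1 osc k := h₃ 1 osc k hosc1
  have hl0 : 0 ≤ levelValue su2Rep L β 0 := h₃ L β 0 hβ1
  have hlk : 0 ≤ levelValue su2Rep L β k := h₃ L β k hβ1
  have hμ0B : 0 < levelValue su2Rep 1 B 0 := h₄ B hB1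
  -- the two one-site comparisons at (B, osc)
  have h2a := H₂ B osc hBB0 hoscB0
  have h2b := H₂ osc B hoscB0 hBB0
  -- names
  set lk := levelValue su2Rep L β k with hlk_def
  set l0 := levelValue su2Rep L β 0 with hl0_def
  set mkB := levelValue su2Rep 1 B k with hmkB_def
  set m0B := levelValue su2Rep 1 B 0 with hm0B_def
  set mko := levelValue su2Rep 1 osc k with hmko_def
  set m0o := levelValue su2Rep 1 osc 0 with hm0o_def
  set e₁ := Real.exp (C₁ * l ^ 2 / L) with he₁_def
  set e := Real.exp ((|C₁| + |C₂| * (|C₁| + 5)) * l ^ 2 / L) with he_def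
  set E₂a := Real.exp (C₂ * (|bareLambda B - bareLambda osc| + (bareLambda B ^ 2 + bareLambda osc ^ 2))) with hE₂a_def
  set E₂b := Real.exp (C₂ * (|bareLambda osc - bareLambda B| + (bareLambda osc ^ 2 + bareLambda B ^ 2))) with hE₂b_def
  constructor
  · -- λ_k(L)·μ₀(osc) ≤ e·(μ_k(osc)·λ₀(L))
    have key : m0B * (lk * m0o) ≤ m0B * (e * (mko * l0)) := by
      calc m0B * (lk * m0o) = (lk * m0B) * m0o := by ring
        _ ≤ (e₁ * (mkB * l0)) * m0o := mul_le_mul_of_nonneg_right hup hμ0o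
        _ = (e₁ * l0) * (mkB * m0o) := by ring
        _ ≤ (e₁ * l0) * (E₂a * (mko * m0B)) :=
            mul_le_mul_of_nonneg_left h2a (mul_nonneg (Real.exp_pos _).le hl0)
        _ = m0B * ((e₁ * E₂a) * (mko * l0)) := by ring
        _ ≤ m0B * (e * (mko * l0)) :=
            mul_le_mul_of_nonneg_left (mul_le_mul_of_nonneg_right he12a (mul_nonneg hμko hl0)) hμ0B.le
    exact le_of_mul_le_mul_left key hμ0B
  · -- μ_k(osc)·λ₀(L) ≤ e·(λ_k(L)·μ₀(osc))
    have key : m0B * (mko * l0) ≤ m0B * (e * (lk * m0o)) := by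
      calc m0B * (mko * l0) = (mko * m0B) * l0 := by ring
        _ ≤ (E₂b * (mkB * m0o)) * l0 := mul_le_mul_of_nonneg_right h2b hl0
        _ = (E₂b * m0o) * (mkB * l0) := by ring
        _ ≤ (E₂b * m0o) * (e₁ * (lk * m0B)) :=
            mul_le_mul_of_nonneg_left hlow (mul_nonneg (Real.exp_pos _).le hμ0o)
        _ = m0B * ((e₁ * E₂b) * (lk * m0o)) := by ring
        _ ≤ m0B * (e * (lk * m0o)) :=
            mul_le_mul_of_nonneg_left (mul_le_mul_of_nonneg_right he12b (mul_nonneg hlk hμ0o)) hμ0B.le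
    exact le_of_mul_le_mul_left key hμ0B

/-! ### v6: the conjunct split U ∧ D of the crux (kernel-checked both ways) -/

private theorem exp_mono_C {C C' l : ℝ} {L : ℕ} [NeZero L] (hC : C ≤ C') :
    Real.exp (C * l ^ 2 / L) ≤ Real.exp (C' * l ^ 2 / L) :=
  Real.exp_le_exp.mpr (div_le_div_of_nonneg_right (mul_le_mul_of_nonneg_right hC (sq_nonneg _)) (Nat.cast_nonneg L))

set_option maxHeartbeats 400000 in
/-- **Composition of the conjunct split (v6): U → D → S3 → the crux, by name.**  Per level `k`: `C := max C_U C_D`, `lam0 := min lam0_U lam0_D (1/2)`,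
`L0 := max L0_U L0_D`; enlarging the constant in front of a product of transfer values uses their non-negativity (S3, at `β ≥ 1` and at the one-site
coupling `B(β,L) ≥ 1/(4lam³) ≥ 1`). -/
theorem RunningReduction_of_halves (hU : Stmt.stub_runningUpper) (hD : Stmt.stub_runningLower) (h₃ : Stmt.stub_transferValuesNonneg) :
    Summit.QuantumFields.YangMills.Theses.LuscherReduction.RunningReduction := by
  show Summit.QuantumFields.YangMills.Theorems.FemtoTransferGap.RunningReduction
  intro k
  obtain ⟨C₁, l₁, hl₁, H₁⟩ := hU k
  obtain ⟨C₂, l₂, hl₂, H₂⟩ := hD k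
  refine ⟨max C₁ C₂, min (min l₁ l₂) (1 / 2), lt_min (lt_min hl₁ hl₂) (by norm_num), ?_⟩
  intro lam hlam hle
  have hle₁ : lam ≤ l₁ := hle.trans ((min_le_left _ _).trans (min_le_left _ _))
  have hle₂ : lam ≤ l₂ := hle.trans ((min_le_left _ _).trans (min_le_right _ _))
  have hhalf : lam ≤ 1 / 2 := hle.trans (min_le_right _ _)
  obtain ⟨L₁, G₁⟩ := H₁ lam hlam hle₁
  obtain ⟨L₂, G₂⟩ := H₂ lam hlam hle₂
  refine ⟨max L₁ L₂, fun L _ hL β hw => ?_⟩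
  have h1 := G₁ L ((le_max_left _ _).trans hL) β hw
  have h2 := G₂ L ((le_max_right _ _).trans hL) β hw
  have hβ1 : 1 ≤ β := hw.1
  have hosc : 1 / (4 * lam ^ 3) ≤ oneSiteCoupling β L := oneSiteCoupling_ge_of_window hlam hw
  have hosc1 : 1 ≤ oneSiteCoupling β L := by
    refine le_trans ?_ hosc
    rw [le_div_iff₀ (by positivity), one_mul]
    have : lam ^ 3 ≤ (1 / 2) ^ 3 := pow_le_pow_left₀ hlam.le hhalf 3
    nlinarith
  have hxk : 0 ≤ levelValue su2Rep L β k := h₃ L β k hβ1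
  have hx0 : 0 ≤ levelValue su2Rep L β 0 := h₃ L β 0 hβ1
  have hzk : 0 ≤ levelValue su2Rep 1 (oneSiteCoupling β L) k := h₃ 1 _ k hosc1
  have hz0 : 0 ≤ levelValue su2Rep 1 (oneSiteCoupling β L) 0 := h₃ 1 _ 0 hosc1
  exact ⟨h1.trans (mul_le_mul_of_nonneg_right (exp_mono_C (le_max_left C₁ C₂)) (mul_nonneg hzk hx0)),
    h2.trans (mul_le_mul_of_nonneg_right (exp_mono_C (le_max_right C₁ C₂)) (mul_nonneg hxk hz0))⟩

/-- Converse bookkeeping: the crux gives U … -/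
theorem runningUpper_of_runningReduction (h : Summit.QuantumFields.YangMills.Theses.LuscherReduction.RunningReduction) : RunningUpper := by
  have h' : Summit.QuantumFields.YangMills.Theorems.FemtoTransferGap.RunningReduction := h
  intro k
  obtain ⟨C, lam0, hlam0, H⟩ := h' k
  refine ⟨C, lam0, hlam0, fun lam hlam hle => ?_⟩
  obtain ⟨L0, HL⟩ := H lam hlam hle
  exact ⟨L0, fun L _ hL β hw => (HL L hL β hw).1⟩

/-- … and D; so U ∧ D is exactly a split of the crux into its two one-sided halves. -/
theorem runningLower_of_runningReduction (h : Summit.QuantumFields.YangMills.Theses.LuscherReduction.RunningReduction) : RunningLower := by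
  have h' : Summit.QuantumFields.YangMills.Theorems.FemtoTransferGap.RunningReduction := h
  intro k
  obtain ⟨C, lam0, hlam0, H⟩ := h' k
  refine ⟨C, lam0, hlam0, fun lam hlam hle => ?_⟩
  obtain ⟨L0, HL⟩ := H lam hlam hle
  exact ⟨L0, fun L _ hL β hw => (HL L hL β hw).2⟩

set_option maxHeartbeats 800000 in
/-- **Honesty lemma (v6): the crux, T2 and positivity give T1 back** — `FemtoBlocking` is the crux in leg-1 currency modulo `OneSiteLevels`
(T2 ⇐ ONE), NOT a weakening: raise the crux at `(L,β)` to the `L`-th power (`e^{±C₁λ²}`), chain with T2 at `b = 2/λ³` (`B(β,L) = L³b`,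
`λ_b(b) = λ`), cancel `λ₀^{os}(B)^L > 0`. Constant `|C₁| + |C₂|`, level `lam ≤ min(l₁, 1, 1/(4max(B₀,1)))`. -/
theorem femtoBlocking_of_runningReduction (h : Summit.QuantumFields.YangMills.Theses.LuscherReduction.RunningReduction)
    (h₂ : Stmt.stub_oneSiteScaling) (h₃ : Stmt.stub_transferValuesNonneg) (h₄ : Stmt.stub_oneSiteTopPos) : FemtoBlocking := by
  have h₁ : Summit.QuantumFields.YangMills.Theorems.FemtoTransferGap.RunningReduction := h
  intro k
  obtain ⟨C₁, l₁, hl₁, H₁⟩ := h₁ k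
  obtain ⟨C₂, B₀, H₂⟩ := h₂ k
  set M : ℝ := max B₀ 1 with hM
  have hM1 : 1 ≤ M := le_max_right _ _
  have hMB : B₀ ≤ M := le_max_left _ _
  have hM0 : 0 < M := by linarith
  refine ⟨|C₁| + |C₂|, min l₁ (min 1 (1 / (4 * M))), lt_min hl₁ (lt_min one_pos (by positivity)), ?_⟩
  intro lam hlam hle
  have hle₁ : lam ≤ l₁ := hle.trans (min_le_left _ _)
  have hlam1 : lam ≤ 1 := (hle.trans (min_le_right _ _)).trans (min_le_left _ _)
  have hleM : lam ≤ 1 / (4 * M) := (hle.trans (min_le_right _ _)).trans (min_le_right _ _)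
  obtain ⟨L0, HL⟩ := H₁ lam hlam hle₁
  refine ⟨L0, ?_⟩
  intro L _ hL β hw
  have hl : 0 < luscherLambda β L := luscherLambda_pos_of_window hlam hw
  have hβ1 : 1 ≤ β := hw.1
  have hl2 : luscherLambda β L ≤ 2 * lam := hw.2.2
  have hosc : oneSiteCoupling β L = (L : ℝ) ^ 3 * (2 / luscherLambda β L ^ 3) := by
    unfold oneSiteCoupling; ring
  have hlb : bareLambda (2 / luscherLambda β L ^ 3) = luscherLambda β L := bareLambda_two_div_cube hl
  obtain ⟨hR1, hR2⟩ := HL L hL β hw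
  set l : ℝ := luscherLambda β L with hl_def
  set b : ℝ := 2 / l ^ 3 with hb_def
  have hLpos : (0 : ℝ) < L := Nat.cast_pos.mpr (NeZero.pos L)
  have hL1 : (1 : ℝ) ≤ L := by exact_mod_cast NeZero.one_le
  -- b ≥ M ≥ max(B₀,1)
  have hbM : M ≤ b := by
    have h1 : 1 / (4 * lam ^ 3) ≤ b := by
      rw [hb_def, div_le_div_iff₀ (by positivity) (by positivity)]
      have : l ^ 3 ≤ (2 * lam) ^ 3 := by gcongr
      nlinarith [this]
    have h2 : M ≤ 1 / (4 * lam ^ 3) := by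
      rw [le_div_iff₀ (by positivity)]
      have hlam3 : lam ^ 3 ≤ lam := pow_le_of_le_one hlam.le hlam1 three_ne_zero
      have h3 := hleM
      rw [le_div_iff₀ (by positivity)] at h3
      calc M * (4 * lam ^ 3) = 4 * M * lam ^ 3 := by ring
        _ ≤ 4 * M * lam := by gcongr
        _ = lam * (4 * M) := by ring
        _ ≤ 1 := h3
    exact h2.trans h1
  have hb1 : 1 ≤ b := hM1.trans hbM
  have hbB0 : B₀ ≤ b := hMB.trans hbM
  have hosc1 : 1 ≤ oneSiteCoupling β L := by
    rw [hosc]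
    have : (1 : ℝ) ≤ (L : ℝ) ^ 3 := one_le_pow₀ hL1
    nlinarith
  obtain ⟨hV1, hV2⟩ := H₂ L b hbB0
  rw [hlb, ← hosc] at hV1 hV2
  -- signs
  have hxk : 0 ≤ levelValue su2Rep L β k := h₃ L β k hβ1
  have hx0 : 0 ≤ levelValue su2Rep L β 0 := h₃ L β 0 hβ1
  have hyk : 0 ≤ levelValue su2Rep 1 b k := h₃ 1 b k hb1
  have hy0 : 0 < levelValue su2Rep 1 b 0 := h₄ b hb1
  have hzk : 0 ≤ levelValue su2Rep 1 (oneSiteCoupling β L) k := h₃ 1 _ k hosc1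
  have hz0 : 0 < levelValue su2Rep 1 (oneSiteCoupling β L) 0 := h₄ _ hosc1
  -- names
  set xk := levelValue su2Rep L β k with hxk_def
  set x0 := levelValue su2Rep L β 0 with hx0_def
  set yk := levelValue su2Rep 1 b k with hyk_def
  set y0 := levelValue su2Rep 1 b 0 with hy0_def
  set zk := levelValue su2Rep 1 (oneSiteCoupling β L) k with hzk_def
  set z0 := levelValue su2Rep 1 (oneSiteCoupling β L) 0 with hz0_def
  have hzL : 0 < z0 ^ L := pow_pos hz0 L
  -- exponential bookkeeping: (e^{C₁l²/L})^L · e^{C₂l²} ≤ e^{(|C₁|+|C₂|)l²}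
  have hexp : Real.exp (C₁ * l ^ 2 / L) ^ L * Real.exp (C₂ * l ^ 2) ≤ Real.exp ((|C₁| + |C₂|) * l ^ 2) := by
    rw [← Real.exp_nat_mul, ← Real.exp_add, Real.exp_le_exp]
    have h1 : C₁ * l ^ 2 ≤ |C₁| * l ^ 2 := mul_le_mul_of_nonneg_right (le_abs_self _) (sq_nonneg _)
    have h2 : C₂ * l ^ 2 ≤ |C₂| * l ^ 2 := mul_le_mul_of_nonneg_right (le_abs_self _) (sq_nonneg _)
    have h3 : (L : ℝ) * (C₁ * l ^ 2 / L) = C₁ * l ^ 2 := by field_simp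
    rw [h3]; linarith
  have hp1 : (xk * z0) ^ L ≤ (Real.exp (C₁ * l ^ 2 / L) * (zk * x0)) ^ L := pow_le_pow_left₀ (mul_nonneg hxk hz0.le) hR1 L
  have hp2 : (zk * x0) ^ L ≤ (Real.exp (C₁ * l ^ 2 / L) * (xk * z0)) ^ L := pow_le_pow_left₀ (mul_nonneg hzk hx0) hR2 L
  refine ⟨?_, ?_⟩
  · -- λ_k(L)^L · μ₀(b) ≤ e · (μ_k(b) · λ₀(L)^L)
    have key : z0 ^ L * (xk ^ L * y0) ≤ z0 ^ L * (Real.exp ((|C₁| + |C₂|) * l ^ 2) * (yk * x0 ^ L)) := by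
      calc z0 ^ L * (xk ^ L * y0) = (xk * z0) ^ L * y0 := by rw [mul_pow]; ring
        _ ≤ (Real.exp (C₁ * l ^ 2 / L) * (zk * x0)) ^ L * y0 := mul_le_mul_of_nonneg_right hp1 hy0.le
        _ = Real.exp (C₁ * l ^ 2 / L) ^ L * x0 ^ L * (zk ^ L * y0) := by rw [mul_pow, mul_pow]; ring
        _ ≤ Real.exp (C₁ * l ^ 2 / L) ^ L * x0 ^ L * (Real.exp (C₂ * l ^ 2) * (yk * z0 ^ L)) :=
            mul_le_mul_of_nonneg_left hV1 (mul_nonneg (pow_nonneg (Real.exp_pos _).le L) (pow_nonneg hx0 L))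
        _ = z0 ^ L * ((Real.exp (C₁ * l ^ 2 / L) ^ L * Real.exp (C₂ * l ^ 2)) * (yk * x0 ^ L)) := by ring
        _ ≤ z0 ^ L * (Real.exp ((|C₁| + |C₂|) * l ^ 2) * (yk * x0 ^ L)) :=
            mul_le_mul_of_nonneg_left (mul_le_mul_of_nonneg_right hexp (mul_nonneg hyk (pow_nonneg hx0 L))) hzL.le
    exact le_of_mul_le_mul_left key hzL
  · -- μ_k(b) · λ₀(L)^L ≤ e · (λ_k(L)^L · μ₀(b))
    have key : z0 ^ L * (yk * x0 ^ L) ≤ z0 ^ L * (Real.exp ((|C₁| + |C₂|) * l ^ 2) * (xk ^ L * y0)) := by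
      calc z0 ^ L * (yk * x0 ^ L) = x0 ^ L * (yk * z0 ^ L) := by ring
        _ ≤ x0 ^ L * (Real.exp (C₂ * l ^ 2) * (zk ^ L * y0)) := mul_le_mul_of_nonneg_left hV2 (pow_nonneg hx0 L)
        _ = Real.exp (C₂ * l ^ 2) * y0 * (zk * x0) ^ L := by rw [mul_pow]; ring
        _ ≤ Real.exp (C₂ * l ^ 2) * y0 * (Real.exp (C₁ * l ^ 2 / L) * (xk * z0)) ^ L :=
            mul_le_mul_of_nonneg_left hp2 (mul_nonneg (Real.exp_pos _).le hy0.le)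
        _ = z0 ^ L * ((Real.exp (C₁ * l ^ 2 / L) ^ L * Real.exp (C₂ * l ^ 2)) * (xk ^ L * y0)) := by rw [mul_pow, mul_pow]; ring
        _ ≤ z0 ^ L * (Real.exp ((|C₁| + |C₂|) * l ^ 2) * (xk ^ L * y0)) :=
            mul_le_mul_of_nonneg_left (mul_le_mul_of_nonneg_right hexp (mul_nonneg (pow_nonneg hxk L) hy0.le)) hzL.le
    exact le_of_mul_le_mul_left key hzL

/-- Sanity (v6): the split line concludes the crux from its own stubs. -/
theorem RunningReduction_of_stubs_halves : Summit.QuantumFields.YangMills.Theses.LuscherReduction.RunningReduction :=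
  RunningReduction_of_halves stub_runningUpper stub_runningLower stub_transferValuesNonneg

/-- The stubs discharge the composition along the RG line (sanity: the only non-whitelisted axiom is the stubs' `sorryAx`).  The Lüscher/Bloch line
discharges it too: `RunningReduction_of_stiff stub_stiffModeDecoupling stub_oneSiteLipschitz stub_transferValuesNonneg stub_oneSiteTopPos`. -/
theorem RunningReduction_of_stubs : Summit.QuantumFields.YangMills.Theses.LuscherReduction.RunningReduction :=
  RunningReduction_of stub_femtoBlocking stub_oneSiteScaling stub_transferValuesNonneg stub_oneSiteTopPos

/-- Sanity: the v4 line still concludes the crux from its own stubs. -/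
theorem RunningReduction_of_stubs_stiff : Summit.QuantumFields.YangMills.Theses.LuscherReduction.RunningReduction :=
  RunningReduction_of_stiff stub_stiffModeDecoupling stub_oneSiteLipschitz stub_transferValuesNonneg stub_oneSiteTopPos

/-! ### T2 is a consequence of crux `OneSiteLevels` (sorry-free; a prover may move it verbatim to a `Theorems/` file `--supports` this crux) -/

set_option maxHeartbeats 800000 in
/-- **`OneSiteLevels → OneSiteScaling`.**  ONE at `b` and at `L³b` (`λ_b(L³b) = λ_b(b)/L`): `μ_k(L³b)^L ≤ e^{−(Δ_kλ_b − Cλ_b²/L)} μ₀(L³b)^L`,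
`μ₀(b) ≤ e^{Δ_kλ_b + Cλ_b²} μ_k(b)`, multiply (the `Δ_kλ_b` cancel) — and symmetrically; constant `2|C|`. -/
theorem oneSiteScaling_of_oneSiteLevels (h : Summit.QuantumFields.YangMills.Theses.LuscherReduction.OneSiteLevels) : OneSiteScaling := by
  have h' : Summit.QuantumFields.YangMills.Theorems.FemtoTransferGap.OneSiteLevels := h
  intro k
  obtain ⟨C, B0, H⟩ := h' k
  refine ⟨2 * |C|, max B0 1, ?_⟩
  intro L _ b hb
  have hb1 : 1 ≤ b := (le_max_right _ _).trans hb
  have hbB0 : B0 ≤ b := (le_max_left _ _).trans hb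
  have hb0 : 0 < b := by linarith
  have hLpos : (0 : ℝ) < L := Nat.cast_pos.mpr (NeZero.pos L)
  have hL1 : (1 : ℝ) ≤ L := by exact_mod_cast NeZero.one_le
  have hL3 : (1 : ℝ) ≤ (L : ℝ) ^ 3 := one_le_pow₀ hL1
  have hBb : b ≤ (L : ℝ) ^ 3 * b := le_mul_of_one_le_left hb0.le hL3
  have hBB0 : B0 ≤ (L : ℝ) ^ 3 * b := hbB0.trans hBb
  have hlamB : bareLambda ((L : ℝ) ^ 3 * b) = bareLambda b / L := bareLambda_cube_mul hb0 L
  obtain ⟨hy0, hUb, hLb⟩ := H b hbB0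
  obtain ⟨hz0, hUB, hLB⟩ := H ((L : ℝ) ^ 3 * b) hBB0
  rw [hlamB] at hUB hLB
  set t : ℝ := bareLambda b with ht_def
  set Δ : ℝ := levelGap k with hΔ_def
  set yk := levelValue su2Rep 1 b k with hyk_def
  set y0 := levelValue su2Rep 1 b 0 with hy0_def
  set zk := levelValue su2Rep 1 ((L : ℝ) ^ 3 * b) k with hzk_def
  set z0 := levelValue su2Rep 1 ((L : ℝ) ^ 3 * b) 0 with hz0_def
  have hzk : 0 ≤ zk := le_trans (mul_nonneg (Real.exp_pos _).le hz0.le) hLB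
  have hyk : 0 ≤ yk := le_trans (mul_nonneg (Real.exp_pos _).le hy0.le) hLb
  -- exponent bookkeeping
  have hc1 : C * t ^ 2 / L ≤ |C| * t ^ 2 := by
    have h1 : C * t ^ 2 / L ≤ |C| * t ^ 2 / L :=
      div_le_div_of_nonneg_right (mul_le_mul_of_nonneg_right (le_abs_self C) (sq_nonneg t)) hLpos.le
    exact h1.trans (div_le_self (mul_nonneg (abs_nonneg C) (sq_nonneg t)) hL1)
  have hc2 : C * t ^ 2 ≤ |C| * t ^ 2 := mul_le_mul_of_nonneg_right (le_abs_self C) (sq_nonneg t)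
  have hA : (L : ℝ) * -(Δ * (t / L) - C * (t / L) ^ 2) = -(Δ * t) + C * t ^ 2 / L := by
    field_simp; ring
  have hB : (L : ℝ) * (Δ * (t / L) + C * (t / L) ^ 2) = Δ * t + C * t ^ 2 / L := by
    field_simp
  have hE1 : (L : ℝ) * -(Δ * (t / L) - C * (t / L) ^ 2) + (Δ * t + C * t ^ 2) ≤ 2 * |C| * t ^ 2 := by rw [hA]; linarith
  have hE2 : -(Δ * t - C * t ^ 2) + (L : ℝ) * (Δ * (t / L) + C * (t / L) ^ 2) ≤ 2 * |C| * t ^ 2 := by rw [hB]; linarith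
  refine ⟨?_, ?_⟩
  · -- μ_k(L³b)^L μ₀(b) ≤ e^{2|C|t²} μ_k(b) μ₀(L³b)^L
    have h1 : zk ^ L ≤ Real.exp ((L : ℝ) * -(Δ * (t / L) - C * (t / L) ^ 2)) * z0 ^ L := by
      have := pow_le_pow_left₀ hzk hUB L
      rwa [mul_pow, ← Real.exp_nat_mul] at this
    have h2 : y0 ≤ Real.exp (Δ * t + C * t ^ 2) * yk := le_exp_mul_of_exp_neg_mul_le hLb
    calc zk ^ L * y0 ≤ (Real.exp ((L : ℝ) * -(Δ * (t / L) - C * (t / L) ^ 2)) * z0 ^ L) * (Real.exp (Δ * t + C * t ^ 2) * yk) :=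
          mul_le_mul h1 h2 hy0.le (mul_nonneg (Real.exp_pos _).le (pow_nonneg hz0.le L))
      _ = Real.exp ((L : ℝ) * -(Δ * (t / L) - C * (t / L) ^ 2) + (Δ * t + C * t ^ 2)) * (yk * z0 ^ L) := by
          conv_rhs => rw [Real.exp_add]
          ring
      _ ≤ Real.exp (2 * |C| * t ^ 2) * (yk * z0 ^ L) :=
          mul_le_mul_of_nonneg_right (Real.exp_le_exp.mpr hE1) (mul_nonneg hyk (pow_nonneg hz0.le L))
  · -- μ_k(b) μ₀(L³b)^L ≤ e^{2|C|t²} μ_k(L³b)^L μ₀(b)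
    have h3 : yk ≤ Real.exp (-(Δ * t - C * t ^ 2)) * y0 := hUb
    have h4 : z0 ^ L ≤ Real.exp ((L : ℝ) * (Δ * (t / L) + C * (t / L) ^ 2)) * zk ^ L := by
      have h := pow_le_pow_left₀ (mul_nonneg (Real.exp_pos _).le hz0.le) hLB L
      rw [mul_pow, ← Real.exp_nat_mul, mul_neg] at h
      exact le_exp_mul_of_exp_neg_mul_le h
    calc yk * z0 ^ L ≤ (Real.exp (-(Δ * t - C * t ^ 2)) * y0) * (Real.exp ((L : ℝ) * (Δ * (t / L) + C * (t / L) ^ 2)) * zk ^ L) :=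
          mul_le_mul h3 h4 (pow_nonneg hz0.le L) (mul_nonneg (Real.exp_pos _).le hy0.le)
      _ = Real.exp (-(Δ * t - C * t ^ 2) + (L : ℝ) * (Δ * (t / L) + C * (t / L) ^ 2)) * (zk ^ L * y0) := by
          conv_rhs => rw [Real.exp_add]
          ring
      _ ≤ Real.exp (2 * |C| * t ^ 2) * (zk ^ L * y0) :=
          mul_le_mul_of_nonneg_right (Real.exp_le_exp.mpr hE2) (mul_nonneg (pow_nonneg hzk L) hy0.le)

/-! ### The located finding behind v5 (owner audit, kernel-checked) -/

/-- **S1 is implied by the crux itself**: take `B := B(β,L)` (`B ≤ 2B` since `B ≥ 1/(4lam³) > 0`; `λ_b(B) = λ/L` exactly); S1's comparison is then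
the crux's with `C ↦ |C|` (transfer values are `≥ 0` at `β, B ≥ 1`, landed `transferValuesNonneg`).  So v4's line reads crux ⟹ S1 trivially and
S1 ∧ S2 ⟹ crux: the difficulty is not split, which is what v5's RG line (T1, T2) repairs. -/
theorem stiffModeDecoupling_of_runningReduction (h : Summit.QuantumFields.YangMills.Theses.LuscherReduction.RunningReduction) :
    StiffModeDecoupling := by
  have h' : Summit.QuantumFields.YangMills.Theorems.FemtoTransferGap.RunningReduction := h
  intro k
  obtain ⟨C, lam0, hlam0, H⟩ := h' k
  refine ⟨|C|, min lam0 (1 / 2), lt_min hlam0 (by norm_num), fun lam hlam hle => ?_⟩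
  have hle0 : lam ≤ lam0 := hle.trans (min_le_left _ _)
  have hhalf : lam ≤ 1 / 2 := hle.trans (min_le_right _ _)
  obtain ⟨L0, HL⟩ := H lam hlam hle0
  refine ⟨L0, fun L _ hL β hw => ?_⟩
  obtain ⟨hup, hlow⟩ := HL L hL β hw
  have hl : 0 < luscherLambda β L := luscherLambda_pos_of_window hlam hw
  have hβ1 : 1 ≤ β := hw.1
  have hosc : 1 / (4 * lam ^ 3) ≤ oneSiteCoupling β L := oneSiteCoupling_ge_of_window hlam hw
  have hosc1 : 1 ≤ oneSiteCoupling β L := by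
    refine le_trans ?_ hosc
    rw [le_div_iff₀ (by positivity), one_mul]
    have : lam ^ 3 ≤ (1 / 2) ^ 3 := pow_le_pow_left₀ hlam.le hhalf 3
    nlinarith
  have hLpos : (0 : ℝ) < L := Nat.cast_pos.mpr (NeZero.pos L)
  have he : Real.exp (C * luscherLambda β L ^ 2 / L) ≤ Real.exp (|C| * luscherLambda β L ^ 2 / L) := by
    apply Real.exp_le_exp.mpr
    exact div_le_div_of_nonneg_right (mul_le_mul_of_nonneg_right (le_abs_self C) (sq_nonneg _)) hLpos.le
  have hn := Summit.QuantumFields.YangMills.Theorems.FemtoTransferGap.transferValuesNonneg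
  have hxk : 0 ≤ levelValue su2Rep L β k := hn L β k hβ1
  have hx0 : 0 ≤ levelValue su2Rep L β 0 := hn L β 0 hβ1
  have hzk : 0 ≤ levelValue su2Rep 1 (oneSiteCoupling β L) k := hn 1 _ k hosc1
  have hz0 : 0 ≤ levelValue su2Rep 1 (oneSiteCoupling β L) 0 := hn 1 _ 0 hosc1
  refine ⟨oneSiteCoupling β L, by linarith, ?_, ?_, ?_⟩
  · rw [bareLambda_oneSiteCoupling hl, sub_self, abs_zero]; positivity
  · exact hup.trans (mul_le_mul_of_nonneg_right he (mul_nonneg hzk hx0))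
  · exact hlow.trans (mul_le_mul_of_nonneg_right he (mul_nonneg hxk hz0))

end Summit.QuantumFields.YangMills.Cruxes.RunningReduction.Birth

end
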